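import Summits.BirchSwinnertonDyer.Rank1Residual.ManinAdditive.TwistOrbitManinNearInvariance
import Summits.BirchSwinnertonDyer.Rank1Residual.ManinAdditive.TwistOrbitIndexEngineOdd
import HarnessLib
import HarnessLib.Audit.Tags

/-!
# §29a (g6) THE OPTIMAL-ORBIT INDEX ENGINE AT `2` WITH ITS MANIN–DISCRIMINANT IDENTITIES
# (cell `bsd-f2-manin`, seat `-an`, analytic / period-lattice lens)

The `p = 2` twin of §24's valuation-form trichotomy (`TwistOrbitIndexEngineOdd`), on SAME-CONDUCTOR
`χ₈` / `χ₋₈` orbits (`d = ±2`, `2⁶ ∣ N = N′`):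

* LATTICE INPUT (tree): the half-Gauss-sum two-sided steps at `2`
  (`half_gaussSum_mul_mem_periodLattice_twoSided_of_char`, `(2k)² ∣ N`, here `k = 4`) feed the index engine
  `optimal_orbit_trichotomy_full` with the twisting parameter `s = g(χ)/2`, `s² = d`, `‖s‖² = 2` PRIME; the
  equal-degree (flip) branch is excluded on commuting pairs by the landed degree jump `optimal_commuting_degree`.
* OUTPUT (PROVED): `optimal_orbit_dichotomy_full_two_of_char` (generic in the character) and its `χ₈` / `χ₋₈`
  specialisations — on a commuting optimal `±2`-pair `deg′ = 2·deg ∧ c′¹²Δ(W′) = c¹²d⁶Δ(W)` or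
  `2·deg′ = deg ∧ c′¹²d⁶Δ(W′) = c¹²Δ(W)`; valuation form (globally minimal models)
  `twoTwist_optimal_orbit_dichotomy_val`:
  `(deg′ = 2·deg ∧ 12·v₂(c′) + v₂Δ′ = 12·v₂(c) + 6 + v₂Δ) ∨ (2·deg′ = deg ∧ 12·v₂(c′) + 6 + v₂Δ′ = 12·v₂(c) + v₂Δ)`.

Consumed by `TwistOrbitManinNearInvarianceAtTwo` (§29b: Manin near-invariance at `2`).  Nothing conjectural is
asserted; no summit statement is touched. [cite: Stevens1989, Lemma (5.4) p. 97] [cite: Watkins2002, §2.1]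
[cite: Cremona1997, §2.8]
-/

noncomputable section

open scoped MatrixGroups ModularForm

open CongruenceSubgroup WeierstrassCurve
  Literature.NumberTheory.DiophantineGeometry
  Literature.NumberTheory.EllipticCurves
  Literature.NumberTheory.EllipticCurves.ModularForms

namespace Summit.BirchSwinnertonDyer.Rank1Residual.ManinAdditive

section IndexEngineAtTwo

/-- `v₂(±2) = 1`. -/
theorem padicValInt_two_of_eq_two_or {d : ℤ} (hd : d = 2 ∨ d = -2) : padicValInt 2 d = 1 := by
  rcases hd with rfl | rfl <;> simp [padicValInt]

/-! ### Lattice input: the index engine at `2` with its Manin–discriminant identities -/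

/-- **THE OPTIMAL-ORBIT DICHOTOMY at `2` WITH ITS MANIN–DISCRIMINANT IDENTITIES, generic in the character**
(the index engine `optimal_orbit_trichotomy_full` fed with the half-Gauss-sum two-sided steps at `2`,
`s = g(χ)/2`, `‖s‖² = 2`; the equal-degree branch is excluded by the degree jump `optimal_commuting_degree`):
on a commuting same-level `χ`-orbit (`u • (W ⊗ d) = W′`, `|d| = 2`, `(2k)² ∣ N`) of lattice-optimal data,
`deg′ = 2·deg ∧ c′¹²Δ(W′) = c¹²d⁶Δ(W)` or `2·deg′ = deg ∧ c′¹²d⁶Δ(W′) = c¹²Δ(W)`. -/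
theorem optimal_orbit_dichotomy_full_two_of_char {d : ℤ} (hd : d ≠ 0) {k : ℕ} [NeZero k]
    (h16 : 4 ^ 2 ∣ (2 * k) ^ 2)
    {χ : DirichletCharacter ℂ (2 * k)} (hχ : χ.IsQuadratic) (hprim : χ.IsPrimitive)
    (hG : gaussSum χ (ZMod.stdAddChar (N := 2 * k)) ^ 2 = 4 * ((d : ℤ) : ℂ))
    (ε : ℕ → ℤ) (hε : ∀ n : ℕ, ¬ 2 ∣ n → (ε n).natAbs = 1) (hεχ : ∀ n : ℕ, (ε n : ℂ) = χ n)
    (hodd : ∀ (X : WeierstrassCurve ℚ) [X.IsElliptic] (n : ℕ), ¬ 2 ∣ n →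
      (X.quadraticTwist ((d : ℤ) : ℚ)).LFunction n = ε n * X.LFunction n)
    (hsq : ∀ n : ℕ, ¬ 2 ∣ n → χ n * χ n = 1) (heven : ∀ n : ℕ, 2 ∣ n → χ n = 0)
    (hsumOf : ∀ {N : ℕ} [NeZero N] (f : CuspForm (Gamma0 N) 2),
      (∀ x : ℚ, modularSymbol f (x + 1 / 2) = -modularSymbol f x) →
      ∀ x : ℚ, ∃ (u₁ u₂ : ZMod (2 * k)) (ε : ℤ),
        ∑ u : ZMod (2 * k), χ u * modularSymbol f (x + twistShift u) =
          2 * (modularSymbol f (x + twistShift u₁) + ε * modularSymbol f (x + twistShift u₂)))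
    (ha : |(d : ℝ)| = 2)
    {W W' : WeierstrassCurve ℚ} [W.IsElliptic] [W.IsGloballyMinimal] [W'.IsElliptic]
    [W'.IsGloballyMinimal] [NeZero (W.conductorNorm ℤ)] [NeZero (W'.conductorNorm ℤ)]
    (u : VariableChange ℚ) (D : ModularParametrizationData W (W.conductorNorm ℤ))
    (D' : ModularParametrizationData W' (W'.conductorNorm ℤ)) (hMW : (2 * k) ^ 2 ∣ W.conductorNorm ℤ)
    (hN : W'.conductorNorm ℤ = W.conductorNorm ℤ) (hu : u • W.quadraticTwist ((d : ℤ) : ℚ) = W')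
    (hD : IsLatticeOptimal D) (hD' : IsLatticeOptimal D') :
    (D'.modularDegree = 2 * D.modularDegree ∧
        (D'.c : ℚ) ^ 12 * W'.Δ = (D.c : ℚ) ^ 12 * ((((d : ℤ) : ℚ)) ^ 6 * W.Δ)) ∨
    (2 * D'.modularDegree = D.modularDegree ∧
        (D'.c : ℚ) ^ 12 * ((((d : ℤ) : ℚ)) ^ 6 * W'.Δ) = (D.c : ℚ) ^ 12 * W.Δ) := by
  haveI : Fact (Nat.Prime 2) := ⟨Nat.prime_two⟩
  haveI : NeZero (2 * k) := ⟨mul_ne_zero two_ne_zero (NeZero.ne k)⟩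
  have hd0 : ((d : ℤ) : ℚ) ≠ 0 := by exact_mod_cast hd
  have hM' : (2 * k) ^ 2 ∣ W'.conductorNorm ℤ := by rw [hN]; exact hMW
  have h4 : 2 ^ 2 ∣ W.conductorNorm ℤ := dvd_trans (pow_dvd_pow_of_dvd (dvd_mul_right 2 k) 2) hMW
  have h4' : 2 ^ 2 ∣ W'.conductorNorm ℤ := dvd_trans (pow_dvd_pow_of_dvd (dvd_mul_right 2 k) 2) hM'
  obtain ⟨hngW, hnmW⟩ := not_good_and_not_mult_of_sq_dvd_conductorNorm W h4
  obtain ⟨hngW', hnmW'⟩ := not_good_and_not_mult_of_sq_dvd_conductorNorm W' h4'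
  have hW0 : ∀ n : ℕ, 2 ∣ n → W.LFunction n = 0 := fun n hn ↦
    W.LFunction_apply_eq_zero_of_not_good_of_not_mult 2 hngW hnmW hn
  have hW'0 : ∀ n : ℕ, 2 ∣ n → W'.LFunction n = 0 := fun n hn ↦
    W'.LFunction_apply_eq_zero_of_not_good_of_not_mult 2 hngW' hnmW' hn
  have habs := natAbs_LFunction_eq_of_twist_even hd0 u hu ε hε (hodd W) hW0 hW'0
  have hodd' : ∀ (X : WeierstrassCurve ℚ) [X.IsElliptic] (n : ℕ), ¬ 2 ∣ n →
      (((X.quadraticTwist ((d : ℤ) : ℚ)).LFunction n : ℤ) : ℂ) = χ n * (X.LFunction n : ℂ) :=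
    fun X _ n hn ↦ by rw [hodd X n hn, Int.cast_mul, hεχ]
  obtain ⟨h1, h2⟩ := half_gaussSum_mul_mem_periodLattice_twoSided_of_char hd h16 hχ hprim hodd' hsq
    heven hsumOf u D D' hMW hN hu
  have hs : (gaussSum χ (ZMod.stdAddChar (N := 2 * k)) / 2) ^ 2 = ((((d : ℤ) : ℚ)) : ℂ) := by
    rw [div_pow, hG]; push_cast; ring
  have hs0 : gaussSum χ (ZMod.stdAddChar (N := 2 * k)) / 2 ≠ 0 := by
    intro h0
    rw [h0] at hs
    have : (((d : ℤ) : ℚ) : ℂ) = 0 := by rw [← hs]; simp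
    exact hd0 (by exact_mod_cast this)
  have ha' : |((((d : ℤ) : ℚ)) : ℝ)| = (2 : ℕ) := by rw [Rat.cast_intCast]; exact_mod_cast ha
  have ha2 : ‖gaussSum χ (ZMod.stdAddChar (N := 2 * k)) / 2‖ ^ 2 = (2 : ℕ) := by
    rw [← norm_pow, hs, Complex.norm_ratCast, ← ha']
  have hcoef : ∀ n : ℕ, ‖cuspCoeff D'.f n‖ = ‖cuspCoeff D.f n‖ := fun n ↦ by
    rw [D'.isNewformOf.2 n, D.isNewformOf.2 n, Complex.norm_intCast, Complex.norm_intCast]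
    have key := congrArg (fun m : ℕ ↦ (m : ℝ)) (habs n)
    simp only [Nat.cast_natAbs, Int.cast_abs] at key
    exact key
  have hjump := optimal_commuting_degree hN D D' hD hD' hd0 hs0 hs h1 h2 u hu habs ha'
    (fun m hm ↦ (Nat.dvd_prime Nat.prime_two).mp hm)
  have hpos : 0 < D.modularDegree := D.deg_pos
  rcases optimal_orbit_trichotomy_full hN D D' hD hD' hd0 hs0 hs Nat.prime_two ha2 h1 h2 hcoef with
    ⟨-, hdeg, hΔ⟩ | ⟨-, hdeg, hΔ⟩ | ⟨hdeg, -, -⟩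
  · exact Or.inl ⟨hdeg, hΔ⟩
  · exact Or.inr ⟨hdeg, hΔ⟩
  · exfalso
    rcases hjump with h | h <;> rw [hdeg] at h <;> omega

/-- **The dichotomy with identities at `d = 2` (`χ₈`, `64 ∣ M ∣ N`).** [cite: Watkins2002, §2.1] -/
theorem two_optimal_orbit_dichotomy_full {M : ℕ} (hM : 64 ∣ M) :
    ∀ (W W' : WeierstrassCurve ℚ) [W.IsElliptic] [W.IsGloballyMinimal] [W'.IsElliptic]
      [W'.IsGloballyMinimal] [NeZero (W.conductorNorm ℤ)] [NeZero (W'.conductorNorm ℤ)]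
      (u : VariableChange ℚ) (D : ModularParametrizationData W (W.conductorNorm ℤ))
      (D' : ModularParametrizationData W' (W'.conductorNorm ℤ)),
      M ∣ W.conductorNorm ℤ → W'.conductorNorm ℤ = W.conductorNorm ℤ →
      u • W.quadraticTwist ((2 : ℤ) : ℚ) = W' → IsLatticeOptimal D → IsLatticeOptimal D' →
      (D'.modularDegree = 2 * D.modularDegree ∧
          (D'.c : ℚ) ^ 12 * W'.Δ = (D.c : ℚ) ^ 12 * ((((2 : ℤ) : ℚ)) ^ 6 * W.Δ)) ∨
      (2 * D'.modularDegree = D.modularDegree ∧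
          (D'.c : ℚ) ^ 12 * ((((2 : ℤ) : ℚ)) ^ 6 * W'.Δ) = (D.c : ℚ) ^ 12 * W.Δ) := by
  intro W W' _ _ _ _ _ _ u D D' hMN hN hu hD hD'
  haveI : NeZero (4 : ℕ) := ⟨by norm_num⟩
  haveI : Fact (Nat.Prime 2) := ⟨Nat.prime_two⟩
  refine optimal_orbit_dichotomy_full_two_of_char (d := 2) (by norm_num) (k := 4) (by norm_num)
    isQuadratic_χ₈_ringHomComp isPrimitive_χ₈_ringHomComp
    (by rw [gaussSum_χ₈_ringHomComp_sq]; push_cast; ring) (fun n ↦ ZMod.χ₈ n) natAbs_χ₈_of_odd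
    (fun n ↦ (χ₈_ringHomComp_apply_natCast n).symm) LFunction_quadraticTwist_two_intCast_of_odd
    (fun n hn ↦ ?_) (fun n hn ↦ ?_)
    (fun f hhalf x ↦ ⟨1, 3, -1, sum_χ₈_modularSymbol_of_half f hhalf x⟩) (by norm_num)
    u D D' ((by norm_num : (2 * 4) ^ 2 ∣ 64).trans (hM.trans hMN)) hN hu hD hD'
  · rw [χ₈_ringHomComp_apply_natCast, ZMod.χ₈_nat_eq_if_mod_eight,
      if_neg (fun h ↦ hn (Nat.dvd_of_mod_eq_zero h))]
    split_ifs <;> push_cast <;> ring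
  · rw [χ₈_ringHomComp_apply_natCast, ZMod.χ₈_nat_eq_if_mod_eight, if_pos (Nat.mod_eq_zero_of_dvd hn)]
    simp

/-- **The dichotomy with identities at `d = −2` (`χ₋₈`, `64 ∣ M ∣ N`).** [cite: Watkins2002, §2.1] -/
theorem negTwo_optimal_orbit_dichotomy_full {M : ℕ} (hM : 64 ∣ M) :
    ∀ (W W' : WeierstrassCurve ℚ) [W.IsElliptic] [W.IsGloballyMinimal] [W'.IsElliptic]
      [W'.IsGloballyMinimal] [NeZero (W.conductorNorm ℤ)] [NeZero (W'.conductorNorm ℤ)]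
      (u : VariableChange ℚ) (D : ModularParametrizationData W (W.conductorNorm ℤ))
      (D' : ModularParametrizationData W' (W'.conductorNorm ℤ)),
      M ∣ W.conductorNorm ℤ → W'.conductorNorm ℤ = W.conductorNorm ℤ →
      u • W.quadraticTwist ((-2 : ℤ) : ℚ) = W' → IsLatticeOptimal D → IsLatticeOptimal D' →
      (D'.modularDegree = 2 * D.modularDegree ∧
          (D'.c : ℚ) ^ 12 * W'.Δ = (D.c : ℚ) ^ 12 * ((((-2 : ℤ) : ℚ)) ^ 6 * W.Δ)) ∨
      (2 * D'.modularDegree = D.modularDegree ∧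
          (D'.c : ℚ) ^ 12 * ((((-2 : ℤ) : ℚ)) ^ 6 * W'.Δ) = (D.c : ℚ) ^ 12 * W.Δ) := by
  intro W W' _ _ _ _ _ _ u D D' hMN hN hu hD hD'
  haveI : NeZero (4 : ℕ) := ⟨by norm_num⟩
  haveI : Fact (Nat.Prime 2) := ⟨Nat.prime_two⟩
  refine optimal_orbit_dichotomy_full_two_of_char (d := -2) (by norm_num) (k := 4) (by norm_num)
    isQuadratic_χ₈'_ringHomComp isPrimitive_χ₈'_ringHomComp
    (by rw [gaussSum_χ₈'_ringHomComp_sq]; push_cast; ring) (fun n ↦ ZMod.χ₈' n) natAbs_χ₈'_of_odd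
    (fun n ↦ (χ₈'_ringHomComp_apply_natCast n).symm) LFunction_quadraticTwist_negTwo_intCast_of_odd
    (fun n hn ↦ ?_) (fun n hn ↦ ?_)
    (fun f hhalf x ↦ ⟨1, 3, 1, sum_χ₈'_modularSymbol_of_half f hhalf x⟩) (by norm_num)
    u D D' ((by norm_num : (2 * 4) ^ 2 ∣ 64).trans (hM.trans hMN)) hN hu hD hD'
  · rw [χ₈'_ringHomComp_apply_natCast, ZMod.χ₈'_nat_eq_if_mod_eight,
      if_neg (fun h ↦ hn (Nat.dvd_of_mod_eq_zero h))]
    split_ifs <;> push_cast <;> ring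
  · rw [χ₈'_ringHomComp_apply_natCast, ZMod.χ₈'_nat_eq_if_mod_eight, if_pos (Nat.mod_eq_zero_of_dvd hn)]
    simp

/-- **The dichotomy with identities at `d = ±2`, uniform statement** (`2⁶ ∣ N`). -/
theorem twoTwist_optimal_orbit_dichotomy_full {d : ℤ} (hd : d = 2 ∨ d = -2) :
    ∀ (W W' : WeierstrassCurve ℚ) [W.IsElliptic] [W.IsGloballyMinimal] [W'.IsElliptic]
      [W'.IsGloballyMinimal] [NeZero (W.conductorNorm ℤ)] [NeZero (W'.conductorNorm ℤ)]
      (u : VariableChange ℚ) (D : ModularParametrizationData W (W.conductorNorm ℤ))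
      (D' : ModularParametrizationData W' (W'.conductorNorm ℤ)),
      2 ^ 6 ∣ W.conductorNorm ℤ → W'.conductorNorm ℤ = W.conductorNorm ℤ →
      u • W.quadraticTwist ((d : ℤ) : ℚ) = W' → IsLatticeOptimal D → IsLatticeOptimal D' →
      (D'.modularDegree = 2 * D.modularDegree ∧
          (D'.c : ℚ) ^ 12 * W'.Δ = (D.c : ℚ) ^ 12 * ((((d : ℤ) : ℚ)) ^ 6 * W.Δ)) ∨
      (2 * D'.modularDegree = D.modularDegree ∧
          (D'.c : ℚ) ^ 12 * ((((d : ℤ) : ℚ)) ^ 6 * W'.Δ) = (D.c : ℚ) ^ 12 * W.Δ) := by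
  intro W W' _ _ _ _ _ _ u D D' hM hN hu hD hD'
  rcases hd with rfl | rfl
  · exact two_optimal_orbit_dichotomy_full (M := 64) (dvd_refl _) W W' u D D' (by simpa using hM)
      hN hu hD hD'
  · exact negTwo_optimal_orbit_dichotomy_full (M := 64) (dvd_refl _) W W' u D D' (by simpa using hM)
      hN hu hD hD'

/-- **Valuation form of the dichotomy at `2`** (globally minimal models, no Manin input): on a commuting
optimal `±2`-pair with `2⁶ ∣ N = N′`,
`(deg′ = 2·deg ∧ 12·v₂(c′) + v₂Δ′ = 12·v₂(c) + 6 + v₂Δ) ∨ (2·deg′ = deg ∧ 12·v₂(c′) + 6 + v₂Δ′ = 12·v₂(c) + v₂Δ)`. -/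
theorem twoTwist_optimal_orbit_dichotomy_val {d : ℤ} (hd : d = 2 ∨ d = -2) :
    ∀ (W W' : WeierstrassCurve ℚ) [W.IsElliptic] [W.IsGloballyMinimal] [W'.IsElliptic]
      [W'.IsGloballyMinimal] [NeZero (W.conductorNorm ℤ)] [NeZero (W'.conductorNorm ℤ)]
      (u : VariableChange ℚ) (D : ModularParametrizationData W (W.conductorNorm ℤ))
      (D' : ModularParametrizationData W' (W'.conductorNorm ℤ)),
      2 ^ 6 ∣ W.conductorNorm ℤ → W'.conductorNorm ℤ = W.conductorNorm ℤ →
      u • W.quadraticTwist ((d : ℤ) : ℚ) = W' → IsLatticeOptimal D → IsLatticeOptimal D' →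
      (D'.modularDegree = 2 * D.modularDegree ∧
          12 * padicValInt 2 D'.c + padicValInt 2 W'.minimalDiscriminantInt =
            12 * padicValInt 2 D.c + 6 + padicValInt 2 W.minimalDiscriminantInt) ∨
      (2 * D'.modularDegree = D.modularDegree ∧
          12 * padicValInt 2 D'.c + 6 + padicValInt 2 W'.minimalDiscriminantInt =
            12 * padicValInt 2 D.c + padicValInt 2 W.minimalDiscriminantInt) := by
  intro W W' _ _ _ _ _ _ u D D' hM hN hu hD hD'
  haveI : Fact (Nat.Prime 2) := ⟨Nat.prime_two⟩
  have hdZ : d ≠ 0 := by rcases hd with rfl | rfl <;> norm_num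
  have hvd := padicValInt_two_of_eq_two_or hd
  have hcZ : D.c ≠ 0 := Int.cast_ne_zero.mp D.cast_c_ne_zero
  have hcZ' : D'.c ≠ 0 := Int.cast_ne_zero.mp D'.cast_c_ne_zero
  have hΔm : W.minimalDiscriminantInt ≠ 0 := W.minimalDiscriminantInt_ne_zero
  have hΔm' : W'.minimalDiscriminantInt ≠ 0 := W'.minimalDiscriminantInt_ne_zero
  rcases twoTwist_optimal_orbit_dichotomy_full hd W W' u D D' hM hN hu hD hD' with
    ⟨hdeg, hΔ⟩ | ⟨hdeg, hΔ⟩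
  · left
    refine ⟨hdeg, ?_⟩
    rw [← W.cast_minimalDiscriminantInt, ← W'.cast_minimalDiscriminantInt] at hΔ
    have hZ : D'.c ^ 12 * W'.minimalDiscriminantInt = D.c ^ 12 * (d ^ 6 * W.minimalDiscriminantInt) := by
      exact_mod_cast hΔ
    have hv := congrArg (padicValInt 2) hZ
    rw [padicValInt.mul (pow_ne_zero _ hcZ') hΔm',
      padicValInt.mul (pow_ne_zero _ hcZ) (mul_ne_zero (pow_ne_zero _ hdZ) hΔm),
      padicValInt.mul (pow_ne_zero _ hdZ) hΔm, padicValInt_pow', padicValInt_pow', padicValInt_pow',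
      hvd] at hv
    push_cast at hv
    omega
  · right
    refine ⟨hdeg, ?_⟩
    rw [← W.cast_minimalDiscriminantInt, ← W'.cast_minimalDiscriminantInt] at hΔ
    have hZ : D'.c ^ 12 * (d ^ 6 * W'.minimalDiscriminantInt) = D.c ^ 12 * W.minimalDiscriminantInt := by
      exact_mod_cast hΔ
    have hv := congrArg (padicValInt 2) hZ
    rw [padicValInt.mul (pow_ne_zero _ hcZ') (mul_ne_zero (pow_ne_zero _ hdZ) hΔm'),
      padicValInt.mul (pow_ne_zero _ hdZ) hΔm', padicValInt.mul (pow_ne_zero _ hcZ) hΔm,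
      padicValInt_pow', padicValInt_pow', padicValInt_pow', hvd] at hv
    push_cast at hv
    omega

end IndexEngineAtTwo

end Summit.BirchSwinnertonDyer.Rank1Residual.ManinAdditive

end
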